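import Summits.QuantumFields.BalabanUV.T4Continuum.Support.NE3QuadRemainderLevels
import HarnessLib

/-!
# T⁴ programme, node NE3, route Π item Π-C (file Π-C-3b) — THE k-FOLD QUADRATIC REMAINDER OF BAŁABAN'S AVERAGE AT A CURVED SMALL-FIELD
# BACKGROUND, SUP FORM, k-FREE:  `sup‖relIter L k W X − dirIter L k W X‖ ≤ C₂(d,L)·(L^k·sup‖X‖)²`, `C₂ = 4(3+12d)³∕rho0(d,L)²`
# — [Balaban1985Averaging] Prop. 4 (134)–(135) TYPE (= [Balaban1985Variational] (44)) in its printed currency, on OUR frame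

NE3 formalisation swarm `b2b-balaban-t4-ne3-formalise-*`, LEAF PROVER 02 (gen 7); route Π item Π-C of the owner's design note
`HOME/t4/b2b-balaban-t4-ne3-p1/g24/D-ne3p1-g24-1.md` §6 + §8 (iv′); SHAPE `HOME/t4/b2b-balaban-t4-ne3-formalise-leaf-02/g7/PI-C-SHAPE-leaf02g7.md`;
INTENT HOME/CLAIMS.log l.22318, owner GO («GO AS SHAPED») l.22393.

THE ARGUMENT ((127)–(133) of the source, on the tree's objects).  Let `W_j := cavgIter L j W`, `X_j := relIter L j W X` (Π-C-2), `D_j := dirIter L j W X`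
(leaf-04), `R_j := X_j − D_j`, `E_j := relStep L W_j X_j − cpush L W_j X_j` (the one-step remainder at level `j`, `≤ 2(s_j∕rho0)²` by leaf-10's
`BlockAverageQuadRemainder` BY NAME).  Then `R_{j+1} = E_j + cpush L W_j R_j` (Π-C-2 `dirIter_push_telescope`), so pushing to the target level,
`‖R_k‖_∞ ≤ Σ_{j<k} ‖dirIter (k−1−j) W_{j+1} E_j‖_∞ ≤ Σ_{j<k} (3+12d)·L^{k−1−j}·2(s_j∕rho0)²` by the k-FREE sup letter of the partial linear towers
(Π-C-1∕3a); with `s_j ≤ (3+12d)L^j s + ‖R_j‖_∞ ≤ 2(3+12d)L^j s` (strong induction on the target level, closed by the smallness line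
`4(3+12d)²·L^K·s ≤ rho0²`) the geometric sum gives `‖R_k‖_∞ ≤ 4(3+12d)³∕rho0²·(L^k s)²` — NO iteration of one-step operator norms (which would cost
`(1+2d)^k`).

CONTENT (all [folklore]; 0 sorry; 0 def): §1 numeric lines from the smallness hypothesis; §2 **`norm_relIter_sub_dirIter_le`** (the END, `∀ k ≤ K`);
§3 `norm_relIter_le` (`‖X_k‖_∞ ≤ 2(3+12d)·L^k·s`), `regime_of_tower` (the level-wise regime of Π-C-2, k-uniformly), **`cavgIter_vary_eq_vary_relIter_of_tower`**
(consistency `cavgIter L k (vary W X 1) = vary (cavgIter L k W) (relIter L k W X) 1`, `∀ k ≤ K`), `relIter_skew_of_tower`; §4 the θ-form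
`norm_relIter_sub_dirIter_le_theta` (curvature line from `LevelSmall` + `17·curv d L ((L²)^K·x) ≤ 8L`, Π-C-1 `curvSum_le_of_levelSmall`).
HYPOTHESES = the tree's multi-level small-field class of the torus (`2 ≤ L`, `W` unitary `(L^K·N)`-periodic, `0 ≤ x`, `LevelSmall d L K x` — one level
of slack —, `SmallField W x`), skew `(L^K·N)`-periodic `X` with `‖X‖ ≤ s`, the summed curvature line `curvSum d L K x ≤ (2∕3)L` and ONE k-free
smallness line (σ) `4(3+12d)²·L^K·s ≤ rho0(d,L)²` (= «α₁ ≤ c₄(d,L)» of Prop. 4; `rho0 = 1∕(256(d+1)L)`).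

HONEST FRAMING.  Kinematics of the k-fold averaging map (42) on OUR frame, in sup currency; the dressed ℓ²∕ℓ¹ forms with decay are NOT here and are false
for general `X` (SHAPE §2; located for the owner∕NE3-R2); nothing about Bałaban's minimisers; `DecomposedRep`'s three sizes, (P♮)_W (K6's), T-E_w♯ and
NE3 are NOT proved here; spine PROVED 0∕9; finite T⁴ rung (B)+1 — NOT infinite volume, NOT mass gap, NOT BetaPertH, NOT Clay.  ABSOLUTE RULE kept (no
printed sentence is a hypothesis; context only: [Balaban1985Averaging] Prop. 3–4 (122)–(135) pp. 36–38; [Balaban1985Variational] (44) p. 285).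
PLACEMENT: `Summits/QuantumFields/BalabanUV/`.  HONEST DEPENDENCY: continuum YM on T⁴ ⇐ BetaPertH ∧ nine spine estimates (0/9 proved); BetaPertH ⇐ (D1) ∧
(D4) ∧ CAP+tail; G-an2-4 gates asym, D1 and NE2/3/4.
-/

set_option autoImplicit false

open scoped BigOperators Matrix.Norms.L2Operator
open Finset

namespace Summit.QuantumFields.BalabanUV.T4Continuum.NE3QuadRemainderSup

open Literature.MathematicalPhysics.QuantumFieldTheory.Balaban1983to89
open B7Prop1Explicit B7Prop2Explicit
open T4AveragingDeficitWall (IsUnitaryCfg IsSkewDir SmallField vary)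
open T4AveragingDeficitWallBoundary (IsPeriodicCfg)
open AveragingDeficitPeriodicCounting (IsPeriodicDir)
open AveragingDeficitChartCalculus (cavg)
open AveragingDeficitMultiLevelPrep (cpush cavgIter radIter LevelSmall)
open BlockAverageVaryHolo (nbRad)
open BlockAverageVaryDisc (rho0 rho0_pos two_le_nbRad)
open NE3TangentCovariantTower (dirIter dirIter_zero)
open NE3LinearisedAverageSup (curv curvSum curvSum_mono curvSum_le_of_levelSmall)
open NE3QuadRemainderTower (relStep relIter relIter_zero cavgIter_vary_eq_vary_relIter relIter_skew dirIter_push_telescope)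
open NE3QuadRemainderLevels (levelPkg norm_dirIter_le_sup_at level_remainder)

noncomputable section

variable {d : ℕ} {n : Type*} [Fintype n] [DecidableEq n]

/-! ## §1 Numeric lines from the smallness hypothesis -/

omit [Fintype n] [DecidableEq n] in
/-- `rho0 d L ≤ 1` (`L ≥ 1`). [folklore] -/
theorem rho0_le_one {L : ℕ} (hL : 1 ≤ L) : rho0 d L ≤ 1 := by
  have h2 := two_le_nbRad (d := d) hL
  have hnb : (2 : ℝ) ≤ nbRad d L := by exact_mod_cast h2
  unfold rho0
  rw [div_le_one (by positivity)]
  nlinarith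

omit [Fintype n] [DecidableEq n] in
/-- THE TWO CONSEQUENCES OF (σ) `4(3+12d)²·L^K·s ≤ rho0²` used below, at every level `i ≤ K`:
`2(3+12d)·L^i·s ≤ rho0∕4` (the disc at every level) and `(4(3+12d)³∕rho0²)·(L^i s)² ≤ (3+12d)·L^i·s` (the remainder never exceeds the linear part). [folklore] -/
theorem sigma_lines {L K : ℕ} (hL : 2 ≤ L) {s : ℝ} (hs : 0 ≤ s)
    (hσ : 4 * (3 + 12 * (d : ℝ)) ^ 2 * (L : ℝ) ^ K * s ≤ rho0 d L ^ 2) {i : ℕ} (hi : i ≤ K) :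
    2 * (3 + 12 * (d : ℝ)) * (L : ℝ) ^ i * s ≤ rho0 d L / 4 ∧
      4 * (3 + 12 * (d : ℝ)) ^ 3 / rho0 d L ^ 2 * ((L : ℝ) ^ i * s) ^ 2 ≤ (3 + 12 * (d : ℝ)) * (L : ℝ) ^ i * s := by
  have hL1 : (1 : ℝ) ≤ L := by exact_mod_cast (show 1 ≤ L by omega)
  have hρ : 0 < rho0 d L := rho0_pos (d := d) (by omega)
  have hρ1 : rho0 d L ≤ 1 := rho0_le_one (d := d) (by omega)
  have hd : (0 : ℝ) ≤ d := Nat.cast_nonneg d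
  have hKl : (3 : ℝ) ≤ 3 + 12 * (d : ℝ) := by linarith
  have hLi : (L : ℝ) ^ i * s ≤ (L : ℝ) ^ K * s := mul_le_mul_of_nonneg_right (pow_le_pow_right₀ hL1 hi) hs
  have hLis : 0 ≤ (L : ℝ) ^ i * s := by positivity
  have h1 : 4 * (3 + 12 * (d : ℝ)) ^ 2 * ((L : ℝ) ^ i * s) ≤ rho0 d L ^ 2 := by nlinarith
  refine ⟨?_, ?_⟩
  · -- `2·Kl·(L^i s) ≤ rho0/4` from `4Kl²(L^i s) ≤ rho0² ≤ rho0·(Kl/2)`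
    nlinarith
  · have e : 4 * (3 + 12 * (d : ℝ)) ^ 3 / rho0 d L ^ 2 * ((L : ℝ) ^ i * s) ^ 2
        = (4 * (3 + 12 * (d : ℝ)) ^ 2 * ((L : ℝ) ^ i * s) / rho0 d L ^ 2) * ((3 + 12 * (d : ℝ)) * ((L : ℝ) ^ i * s)) := by
      ring
    rw [e, show (3 + 12 * (d : ℝ)) * (L : ℝ) ^ i * s = 1 * ((3 + 12 * (d : ℝ)) * ((L : ℝ) ^ i * s)) by ring]
    exact mul_le_mul_of_nonneg_right ((div_le_one (by positivity)).mpr h1) (by positivity)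

/-! ## §2 The END: the k-fold quadratic remainder in sup, k-free -/

/-- **THE k-FOLD QUADRATIC REMAINDER OF THE AVERAGE, SUP FORM, k-FREE** ([Balaban1985Averaging] Prop. 4 (134)–(135) TYPE at a curved background, on the
tree's objects).  For `2 ≤ L`, a unitary `(L^K·N)`-periodic `W` in the tower class (`0 ≤ x`, `LevelSmall d L K x`, `SmallField W x`) with the summed
curvature line `curvSum d L K x ≤ (2∕3)L`, a skew `(L^K·N)`-periodic `X` with `‖X b‖ ≤ s` (`s ≥ 0`) and the smallness line `4(3+12d)²·L^K·s ≤ rho0(d,L)²`: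
for every `k ≤ K` and every bond, `‖relIter L k W X z κ − dirIter L k W X z κ‖ ≤ (4(3+12d)³∕rho0²)·(L^k·s)²`. [cite: Balaban1985Averaging, Prop. 4 (134)–(135) p.38] -/
theorem norm_relIter_sub_dirIter_le [Nonempty n] {L N K : ℕ} [NeZero N] (hL : 2 ≤ L) {W : Site d → Fin d → (Matrix n n ℂ)ˣ} {x : ℝ}
    (hWu : IsUnitaryCfg W) (hWP : IsPeriodicCfg W ((L ^ K * N : ℕ) : ℤ)) (hx : 0 ≤ x) (hsm : LevelSmall d L K x) (hWx : SmallField W x)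
    (hA : curvSum d L K x ≤ 2 / 3 * L) {X : Site d → Fin d → Matrix n n ℂ} (hXs : IsSkewDir X) (hXP : IsPeriodicDir X ((L ^ K * N : ℕ) : ℤ))
    {s : ℝ} (hs : 0 ≤ s) (hX : ∀ (z : Site d) (μ : Fin d), ‖X z μ‖ ≤ s)
    (hσ : 4 * (3 + 12 * (d : ℝ)) ^ 2 * (L : ℝ) ^ K * s ≤ rho0 d L ^ 2) :
    ∀ k : ℕ, k ≤ K → ∀ (z : Site d) (κ : Fin d),
      ‖relIter L k W X z κ - dirIter L k W X z κ‖ ≤ 4 * (3 + 12 * (d : ℝ)) ^ 3 / rho0 d L ^ 2 * ((L : ℝ) ^ k * s) ^ 2 := by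
  have hL1 : 1 ≤ L := by omega
  have hL1r : (1 : ℝ) ≤ L := by exact_mod_cast hL1
  have hρ : 0 < rho0 d L := rho0_pos (d := d) hL1
  have hd : (0 : ℝ) ≤ d := Nat.cast_nonneg d
  set Kl : ℝ := 3 + 12 * (d : ℝ) with hKl
  have hKl3 : (3 : ℝ) ≤ Kl := by rw [hKl]; linarith
  intro k
  induction k using Nat.strong_induction_on with
  | _ k IH =>
  intro hk
  -- (1) the sup of the nonlinear coordinate below the target level
  have hsup : ∀ i < k, ∀ (z : Site d) (μ : Fin d), ‖relIter L i W X z μ‖ ≤ 2 * Kl * (L : ℝ) ^ i * s := by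
    intro i hi z μ
    have hR := IH i hi (by omega) z μ
    have hD : ‖dirIter L i W X z μ‖ ≤ Kl * (L : ℝ) ^ i * s :=
      norm_dirIter_le_sup_at hL hWu hWP hx hsm hWx hA (i := 0) (m := i) (by omega) hXs (by rwa [Nat.sub_zero]) hs hX z μ
    have hC := (sigma_lines (d := d) hL hs hσ (i := i) (by omega)).2
    calc ‖relIter L i W X z μ‖ ≤ ‖dirIter L i W X z μ‖ + ‖relIter L i W X z μ - dirIter L i W X z μ‖ := norm_le_insert' _ _
      _ ≤ Kl * (L : ℝ) ^ i * s + Kl * (L : ℝ) ^ i * s := add_le_add hD (hR.trans hC)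
      _ = 2 * Kl * (L : ℝ) ^ i * s := by ring
  -- (2) the level-wise regime below the target level, hence skewness of every `X_i`, `i ≤ k`
  have hreg : ∀ i < k, ∃ a t : ℝ, 0 ≤ a ∧ 512 * (d + 1) * (d + 4) * (L : ℝ) ^ 2 * a ≤ 1 ∧ IsUnitaryCfg (cavgIter L i W)
      ∧ SmallField (cavgIter L i W) a ∧ 0 ≤ t ∧ (∀ (y : Site d) (κ : Fin d), ‖relIter L i W X y κ‖ ≤ t) ∧ t ≤ rho0 d L / 4 := by
    intro i hi
    obtain ⟨hU, hr, hS, -, h512, -, -⟩ := levelPkg hL1 hWu hWP hx hsm hWx hA (i := i) (by omega)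
    exact ⟨_, _, hr, h512, hU, hS, by positivity, hsup i hi, (sigma_lines (d := d) hL hs hσ (i := i) (by omega)).1⟩
  have hskew : ∀ i ≤ k, IsSkewDir (relIter L i W X) := fun i hi =>
    relIter_skew hL1 i hXs fun i' hi' => hreg i' (by omega)
  -- (3) the target level
  rcases k with _ | k'
  · intro z κ
    rw [relIter_zero, dirIter_zero, sub_self, norm_zero]
    positivity
  · -- the one-step remainders `E_i`, `i ≤ k'`: size `8Kl²(L^i s)²/rho0²`, skew, `(L^{K-i-1}N)`-periodic
    have hE : ∀ i < k' + 1,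
        (∀ (z : Site d) (κ : Fin d), ‖relStep L (cavgIter L i W) (relIter L i W X) z κ - cpush L (cavgIter L i W) (relIter L i W X) z κ‖
            ≤ 2 * (2 * Kl * (L : ℝ) ^ i * s / rho0 d L) ^ 2)
        ∧ IsSkewDir (fun z κ => relStep L (cavgIter L i W) (relIter L i W X) z κ - cpush L (cavgIter L i W) (relIter L i W X) z κ)
        ∧ IsPeriodicDir (fun z κ => relStep L (cavgIter L i W) (relIter L i W X) z κ - cpush L (cavgIter L i W) (relIter L i W X) z κ)
            ((L ^ (K - i - 1) * N : ℕ) : ℤ) := by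
      intro i hi
      obtain ⟨h1, h2, h3, -⟩ := level_remainder hL1 hWu hWP hx hsm hWx hA (i := i) (by omega) hXP (hskew i (by omega))
        (t := 2 * Kl * (L : ℝ) ^ i * s) (by positivity) (hsup i hi) (sigma_lines (d := d) hL hs hσ (i := i) (by omega)).1
      exact ⟨h1, h2, h3⟩
    -- the telescope pushed to the target level `k'+1`
    set B : ℝ := Kl * (8 * Kl ^ 2 * s ^ 2 / rho0 d L ^ 2) * (L : ℝ) ^ k' with hB
    have hB0 : 0 ≤ B := by positivity
    have hQ : ∀ j : ℕ, j ≤ k' → ∀ (z : Site d) (κ : Fin d),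
        ‖dirIter L (k' - j) (cavgIter L (j + 1) W) (fun y μ => relIter L (j + 1) W X y μ - dirIter L (j + 1) W X y μ) z κ‖
          ≤ B * ∑ i ∈ range (j + 1), (L : ℝ) ^ i := by
      intro j
      induction j with
      | zero =>
          intro _ z κ
          obtain ⟨h1, h2, h3⟩ := hE 0 (by omega)
          have h := norm_dirIter_le_sup_at hL hWu hWP hx hsm hWx hA (i := 1) (m := k') (by omega) h2 h3 (by positivity) h1 z κ
          rw [← hKl] at h
          rw [Nat.sub_zero]
          refine (le_of_eq (by rfl)).trans (h.trans (le_of_eq ?_))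
          rw [hB, Finset.sum_range_one, pow_zero]
          ring
      | succ j ihj =>
          intro hj z κ
          obtain ⟨hU1, hr1, hS1, -, h5121, -, -⟩ := levelPkg hL1 hWu hWP hx hsm hWx hA (i := j + 1) (by omega)
          obtain ⟨hU2, hr2, hS2, -, -, hls2, -⟩ := levelPkg hL1 hWu hWP hx hsm hWx hA (i := j + 1 + 1) (by omega)
          have hsm2 : k' - (j + 1) = 0 ∨ LevelSmall d L (k' - (j + 1) - 1) (radIter d L (j + 1 + 1) x) := by
            rcases Nat.eq_zero_or_pos (k' - (j + 1)) with h0 | hpos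
            · exact Or.inl h0
            · exact Or.inr (hls2 (k' - (j + 1)) (by omega) hpos)
          rw [dirIter_push_telescope hL1 (j + 1) (k' - (j + 1)) hU1 hr1 h5121 hS1 hU2 hr2 hsm2 hS2 X z κ,
            show k' - (j + 1) + 1 = k' - j by omega]
          obtain ⟨h1, h2, h3⟩ := hE (j + 1) (by omega)
          have hfirst := norm_dirIter_le_sup_at hL hWu hWP hx hsm hWx hA (i := j + 1 + 1) (m := k' - (j + 1)) (by omega) h2 h3
            (by positivity) h1 z κ
          have hsecond := ihj (by omega) z κ
          refine (norm_add_le _ _).trans ?_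
          have hterm : Kl * (L : ℝ) ^ (k' - (j + 1)) * (2 * (2 * Kl * (L : ℝ) ^ (j + 1) * s / rho0 d L) ^ 2) = B * (L : ℝ) ^ (j + 1) := by
            have hpow : (L : ℝ) ^ (k' - (j + 1)) * (L : ℝ) ^ (j + 1) = (L : ℝ) ^ k' := by
              rw [← pow_add]; congr 1; omega
            calc Kl * (L : ℝ) ^ (k' - (j + 1)) * (2 * (2 * Kl * (L : ℝ) ^ (j + 1) * s / rho0 d L) ^ 2)
                = (8 * Kl ^ 3 * s ^ 2 / rho0 d L ^ 2) * ((L : ℝ) ^ (k' - (j + 1)) * (L : ℝ) ^ (j + 1)) * (L : ℝ) ^ (j + 1) := by ring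
              _ = B * (L : ℝ) ^ (j + 1) := by rw [hpow, hB]; ring
          rw [Finset.sum_range_succ, mul_add, add_comm (B * _)]
          rw [← hKl, hterm] at hfirst
          exact add_le_add hfirst hsecond
    -- read off at `j = k'`: the tower is the identity, the geometric sum is `≤ L^{k'+1}`
    intro z κ
    have h := hQ k' le_rfl z κ
    rw [Nat.sub_self, dirIter_zero] at h
    refine h.trans ?_
    have hgeom : ∑ i ∈ range (k' + 1), (L : ℝ) ^ i ≤ (L : ℝ) ^ (k' + 1) := by
      have hg := NE3LinearisedAverageSup.geom_sum_mul_le L (k' + 1)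
      have hS0 : 0 ≤ ∑ i ∈ range (k' + 1), (L : ℝ) ^ i := Finset.sum_nonneg fun _ _ => by positivity
      have hL2 : (2 : ℝ) ≤ L := by exact_mod_cast hL
      nlinarith
    calc B * ∑ i ∈ range (k' + 1), (L : ℝ) ^ i ≤ B * (L : ℝ) ^ (k' + 1) := mul_le_mul_of_nonneg_left hgeom hB0
      _ = (8 * Kl ^ 3 / rho0 d L ^ 2 * ((L : ℝ) ^ k' * (L : ℝ) ^ (k' + 1))) * s ^ 2 := by rw [hB]; ring
      _ ≤ (8 * Kl ^ 3 / rho0 d L ^ 2 * ((L : ℝ) ^ (k' + 1) * (L : ℝ) ^ (k' + 1) / 2)) * s ^ 2 := by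
          refine mul_le_mul_of_nonneg_right (mul_le_mul_of_nonneg_left ?_ (by positivity)) (sq_nonneg s)
          have hL2 : (2 : ℝ) ≤ L := by exact_mod_cast hL
          have hp : 0 ≤ (L : ℝ) ^ k' := by positivity
          rw [pow_succ]
          nlinarith [mul_nonneg hp hp]
      _ = 4 * Kl ^ 3 / rho0 d L ^ 2 * ((L : ℝ) ^ (k' + 1) * s) ^ 2 := by ring

/-! ## §3 The sup of the nonlinear coordinate, the regime, consistency and skewness at every level -/

/-- **THE SUP OF THE NONLINEAR COORDINATE**: under the hypotheses of `norm_relIter_sub_dirIter_le`, `‖relIter L k W X z κ‖ ≤ 2(3+12d)·L^k·s` for all `k ≤ K`.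
[folklore] -/
theorem norm_relIter_le [Nonempty n] {L N K : ℕ} [NeZero N] (hL : 2 ≤ L) {W : Site d → Fin d → (Matrix n n ℂ)ˣ} {x : ℝ}
    (hWu : IsUnitaryCfg W) (hWP : IsPeriodicCfg W ((L ^ K * N : ℕ) : ℤ)) (hx : 0 ≤ x) (hsm : LevelSmall d L K x) (hWx : SmallField W x)
    (hA : curvSum d L K x ≤ 2 / 3 * L) {X : Site d → Fin d → Matrix n n ℂ} (hXs : IsSkewDir X) (hXP : IsPeriodicDir X ((L ^ K * N : ℕ) : ℤ))
    {s : ℝ} (hs : 0 ≤ s) (hX : ∀ (z : Site d) (μ : Fin d), ‖X z μ‖ ≤ s)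
    (hσ : 4 * (3 + 12 * (d : ℝ)) ^ 2 * (L : ℝ) ^ K * s ≤ rho0 d L ^ 2) {k : ℕ} (hk : k ≤ K) (z : Site d) (κ : Fin d) :
    ‖relIter L k W X z κ‖ ≤ 2 * (3 + 12 * (d : ℝ)) * (L : ℝ) ^ k * s := by
  have hR := norm_relIter_sub_dirIter_le hL hWu hWP hx hsm hWx hA hXs hXP hs hX hσ k hk z κ
  have hD : ‖dirIter L k W X z κ‖ ≤ (3 + 12 * (d : ℝ)) * (L : ℝ) ^ k * s :=
    norm_dirIter_le_sup_at hL hWu hWP hx hsm hWx hA (i := 0) (m := k) (by omega) hXs (by rwa [Nat.sub_zero]) hs hX z κ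
  have hC := (sigma_lines (d := d) hL hs hσ hk).2
  calc ‖relIter L k W X z κ‖ ≤ ‖dirIter L k W X z κ‖ + ‖relIter L k W X z κ - dirIter L k W X z κ‖ := norm_le_insert' _ _
    _ ≤ (3 + 12 * (d : ℝ)) * (L : ℝ) ^ k * s + (3 + 12 * (d : ℝ)) * (L : ℝ) ^ k * s := add_le_add hD (hR.trans hC)
    _ = 2 * (3 + 12 * (d : ℝ)) * (L : ℝ) ^ k * s := by ring

/-- **THE LEVEL-WISE REGIME OF THE TOWER, k-UNIFORMLY**: the ∃-hypothesis of Π-C-2's tower lemmas holds at every level `i < K + 1`. [folklore] -/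
theorem regime_of_tower [Nonempty n] {L N K : ℕ} [NeZero N] (hL : 2 ≤ L) {W : Site d → Fin d → (Matrix n n ℂ)ˣ} {x : ℝ}
    (hWu : IsUnitaryCfg W) (hWP : IsPeriodicCfg W ((L ^ K * N : ℕ) : ℤ)) (hx : 0 ≤ x) (hsm : LevelSmall d L K x) (hWx : SmallField W x)
    (hA : curvSum d L K x ≤ 2 / 3 * L) {X : Site d → Fin d → Matrix n n ℂ} (hXs : IsSkewDir X) (hXP : IsPeriodicDir X ((L ^ K * N : ℕ) : ℤ))
    {s : ℝ} (hs : 0 ≤ s) (hX : ∀ (z : Site d) (μ : Fin d), ‖X z μ‖ ≤ s)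
    (hσ : 4 * (3 + 12 * (d : ℝ)) ^ 2 * (L : ℝ) ^ K * s ≤ rho0 d L ^ 2) :
    ∀ i < K + 1, ∃ a t : ℝ, 0 ≤ a ∧ 512 * (d + 1) * (d + 4) * (L : ℝ) ^ 2 * a ≤ 1 ∧ IsUnitaryCfg (cavgIter L i W)
      ∧ SmallField (cavgIter L i W) a ∧ 0 ≤ t ∧ (∀ (y : Site d) (κ : Fin d), ‖relIter L i W X y κ‖ ≤ t) ∧ t ≤ rho0 d L / 4 := by
  intro i hi
  obtain ⟨hU, hr, hS, -, h512, -, -⟩ := levelPkg (show 1 ≤ L by omega) hWu hWP hx hsm hWx hA (i := i) (by omega)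
  exact ⟨_, _, hr, h512, hU, hS, by positivity, fun y κ => norm_relIter_le hL hWu hWP hx hsm hWx hA hXs hXP hs hX hσ (by omega) y κ,
    (sigma_lines (d := d) hL hs hσ (i := i) (by omega)).1⟩

/-- **CONSISTENCY AT EVERY LEVEL OF THE TOWER**: `cavgIter L k (vary W X 1) = vary (cavgIter L k W) (relIter L k W X) 1` for all `k ≤ K` — the k-fold
relative log-coordinate IS the log-coordinate of the k-fold average of `W·e^{X}` against the k-fold average of `W`. [cite: Balaban1985Averaging, (127) p.37, (134) p.38] -/
theorem cavgIter_vary_eq_vary_relIter_of_tower [Nonempty n] {L N K : ℕ} [NeZero N] (hL : 2 ≤ L) {W : Site d → Fin d → (Matrix n n ℂ)ˣ}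
    {x : ℝ} (hWu : IsUnitaryCfg W) (hWP : IsPeriodicCfg W ((L ^ K * N : ℕ) : ℤ)) (hx : 0 ≤ x) (hsm : LevelSmall d L K x) (hWx : SmallField W x)
    (hA : curvSum d L K x ≤ 2 / 3 * L) {X : Site d → Fin d → Matrix n n ℂ} (hXs : IsSkewDir X) (hXP : IsPeriodicDir X ((L ^ K * N : ℕ) : ℤ))
    {s : ℝ} (hs : 0 ≤ s) (hX : ∀ (z : Site d) (μ : Fin d), ‖X z μ‖ ≤ s)
    (hσ : 4 * (3 + 12 * (d : ℝ)) ^ 2 * (L : ℝ) ^ K * s ≤ rho0 d L ^ 2) {k : ℕ} (hk : k ≤ K) :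
    cavgIter L k (vary W X 1) = vary (cavgIter L k W) (relIter L k W X) 1 :=
  cavgIter_vary_eq_vary_relIter (show 1 ≤ L by omega) k fun i hi =>
    regime_of_tower hL hWu hWP hx hsm hWx hA hXs hXP hs hX hσ i (by omega)

/-- **SKEWNESS AT EVERY LEVEL OF THE TOWER**: `relIter L k W X` is skew for all `k ≤ K`. [folklore] -/
theorem relIter_skew_of_tower [Nonempty n] {L N K : ℕ} [NeZero N] (hL : 2 ≤ L) {W : Site d → Fin d → (Matrix n n ℂ)ˣ}
    {x : ℝ} (hWu : IsUnitaryCfg W) (hWP : IsPeriodicCfg W ((L ^ K * N : ℕ) : ℤ)) (hx : 0 ≤ x) (hsm : LevelSmall d L K x) (hWx : SmallField W x)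
    (hA : curvSum d L K x ≤ 2 / 3 * L) {X : Site d → Fin d → Matrix n n ℂ} (hXs : IsSkewDir X) (hXP : IsPeriodicDir X ((L ^ K * N : ℕ) : ℤ))
    {s : ℝ} (hs : 0 ≤ s) (hX : ∀ (z : Site d) (μ : Fin d), ‖X z μ‖ ≤ s)
    (hσ : 4 * (3 + 12 * (d : ℝ)) ^ 2 * (L : ℝ) ^ K * s ≤ rho0 d L ^ 2) {k : ℕ} (hk : k ≤ K) :
    IsSkewDir (relIter L k W X) :=
  relIter_skew (show 1 ≤ L by omega) k hXs fun i hi => regime_of_tower hL hWu hWP hx hsm hWx hA hXs hXP hs hX hσ i (by omega)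

/-! ## §4 The θ-form -/

/-- **THE END, θ-FORM**: as `norm_relIter_sub_dirIter_le` with the summed curvature line replaced by ONE θ-line `17·curv d L ((L²)^K·x) ≤ 8·L` (a multiple of
the coarse letter `θ = (L^K)²x`; Π-C-1 `curvSum_le_of_levelSmall`). [cite: Balaban1985Averaging, Prop. 4 (134)–(135) p.38] -/
theorem norm_relIter_sub_dirIter_le_theta [Nonempty n] {L N K : ℕ} [NeZero N] (hL : 2 ≤ L) {W : Site d → Fin d → (Matrix n n ℂ)ˣ}
    {x : ℝ} (hWu : IsUnitaryCfg W) (hWP : IsPeriodicCfg W ((L ^ K * N : ℕ) : ℤ)) (hx : 0 ≤ x) (hsm : LevelSmall d L K x) (hWx : SmallField W x)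
    (hθ : 17 * curv d L (((L : ℝ) ^ 2) ^ K * x) ≤ 8 * L) {X : Site d → Fin d → Matrix n n ℂ} (hXs : IsSkewDir X)
    (hXP : IsPeriodicDir X ((L ^ K * N : ℕ) : ℤ)) {s : ℝ} (hs : 0 ≤ s) (hX : ∀ (z : Site d) (μ : Fin d), ‖X z μ‖ ≤ s)
    (hσ : 4 * (3 + 12 * (d : ℝ)) ^ 2 * (L : ℝ) ^ K * s ≤ rho0 d L ^ 2) {k : ℕ} (hk : k ≤ K) (z : Site d) (κ : Fin d) :
    ‖relIter L k W X z κ - dirIter L k W X z κ‖ ≤ 4 * (3 + 12 * (d : ℝ)) ^ 3 / rho0 d L ^ 2 * ((L : ℝ) ^ k * s) ^ 2 := by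
  have hA : curvSum d L K x ≤ 2 / 3 * L := by
    have h1 := curvSum_mono (d := d) L (Nat.le_succ K) hx
    have h2 := curvSum_le_of_levelSmall (d := d) hL K hx hsm
    linarith
  exact norm_relIter_sub_dirIter_le hL hWu hWP hx hsm hWx hA hXs hXP hs hX hσ k hk z κ

end

end Summit.QuantumFields.BalabanUV.T4Continuum.NE3QuadRemainderSup
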